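import Literature.IUT.HodgeTheaters.BadLocalFrobenioid
import Mathlib.CategoryTheory.EssentialImage
import Mathlib.CategoryTheory.Functor.FullyFaithful
import Mathlib.CategoryTheory.Whiskering
import HarnessLib

/-!
# [IUTchI] Remark 3.2.1 (i) reading `ReconstructibleAlong`: the criterion for FULL subcategories
# (merge socket for Example 3.2 (vi) (a) / Example 3.3 (iii) (a), "[AbsAnab] Lemma 1.3.8")

Mochizuki, *Inter-universal Teichmüller theory I*, §3, Remark 3.2.1 (i) ("reconstructed
category-theoretically" = "preserved by equivalences of categories"), Example 3.2 (vi) (a) and Example 3.3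
(iii) (a) ("the subcategory `D⊢_v ⊆ D_v` may be reconstructed category-theoretically from `D_v`", citing
[AbsAnab] Lemma 1.3.8), kurims May-2020 manuscript pp. 72, 74, 78 [claim: Mochizuki2012, status: disputed].
abc-iut cell, WAVE-4 (D-0067) seat abc-iut-w4-d047; DAG nodes `IUTchI:Ex3.2(vi)`, `IUTchI:Ex3.3(iii)`.

abc-iut-L5-t2 typed the reading as `ReconstructibleAlong Φ := ∀ e : S ≌ S, ∃ e' : T ≌ T,
Nonempty (Φ ⋙ e.functor ≅ e'.functor ⋙ Φ)` (`SplitFrobenioids.lean`). `BadLocalFrobenioidClaimsIndependence.lean`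
shows this does NOT follow from `Φ` full + faithful (+ reflective). THIS FILE gives the exact criterion when
`Φ` is FULL AND FAITHFUL (a full subcategory inclusion, the case of `D⊢_v ⊆ D_v`):

  `ReconstructibleAlong Φ ↔ ∀ (e : S ≌ S) (t : T), Φ.essImage (e.functor.obj (Φ.obj t))`

— "every self-equivalence of the ambient category maps the (essential image of the) subcategory into
itself", which is precisely the form in which an anabelian characterisation such as [AbsAnab] Lemma 1.3.8
("`D⊢_v ⊆ D_v` is characterised group-theoretically, i.e. category-theoretically") is used in print. Hence the MERGE SOCKETS
`BadLocalFrobenioid.ddashFromD_of_essImage_invariant` (Ex. 3.2 (vi)(a)) and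
`GoodLocalFrobenioid.ddashFromD_of_essImage_invariant` (Ex. 3.3 (iii)(a)): at merge, the typed node follows
from essential-image invariance alone. Proof: lift `Φ ⋙ e^{±1}` through the fully faithful `Φ`
(`Functor.essImage.liftFunctor`), cancel `Φ` on the right to see that the two lifts are mutually inverse, and
package them as an equivalence (`Equivalence.mk`). Pure category theory; nothing of the disputed series is
asserted; typed ≠ proved.
-/

namespace Literature.IUT.HodgeTheaters

open CategoryTheory

universe u

variable {S T : Type u} [Category.{u} S] [Category.{u} T]

/-- **Necessity** (any `Φ`): if every self-equivalence of `S` lifts along `Φ`, then every self-equivalence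
maps the essential image of `Φ` into itself. [claim: Mochizuki2012, status: disputed] -/
theorem essImage_invariant_of_reconstructibleAlong (Φ : T ⥤ S) (h : ReconstructibleAlong Φ)
    (e : S ≌ S) (t : T) : Φ.essImage (e.functor.obj (Φ.obj t)) := by
  obtain ⟨e', ⟨I⟩⟩ := h e
  exact ⟨e'.functor.obj t, ⟨(I.app t).symm⟩⟩

/-- **Sufficiency for full subcategory inclusions**: if `Φ : T ⥤ S` is full and faithful and every
self-equivalence of `S` maps the essential image of `Φ` into itself, then every self-equivalence `e` of
`S` lifts to a self-equivalence `e'` of `T` with `Φ ⋙ e ≅ e' ⋙ Φ` (the Rmk. 3.2.1 (i) reading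
`ReconstructibleAlong Φ`). [claim: Mochizuki2012, status: disputed] -/
theorem reconstructibleAlong_of_essImage_invariant (Φ : T ⥤ S) [Φ.Full] [Φ.Faithful]
    (h : ∀ (e : S ≌ S) (t : T), Φ.essImage (e.functor.obj (Φ.obj t))) : ReconstructibleAlong Φ := by
  intro e
  have h₁ : ∀ t, Φ.essImage ((Φ ⋙ e.functor).obj t) := fun t => h e t
  have h₂ : ∀ t, Φ.essImage ((Φ ⋙ e.inverse).obj t) := fun t => h e.symm t
  -- the two lifts through the fully faithful `Φ`
  let F' : T ⥤ T := Functor.essImage.liftFunctor (Φ ⋙ e.functor) Φ h₁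
  let G' : T ⥤ T := Functor.essImage.liftFunctor (Φ ⋙ e.inverse) Φ h₂
  let iF : F' ⋙ Φ ≅ Φ ⋙ e.functor := Functor.essImage.liftFunctorCompIso _ _ _
  let iG : G' ⋙ Φ ≅ Φ ⋙ e.inverse := Functor.essImage.liftFunctorCompIso _ _ _
  -- `(F' ⋙ G') ⋙ Φ ≅ 𝟭 ⋙ Φ`
  let cFG : (F' ⋙ G') ⋙ Φ ≅ 𝟭 T ⋙ Φ :=
    Functor.associator F' G' Φ ≪≫ Functor.isoWhiskerLeft F' iG ≪≫ (Functor.associator F' Φ e.inverse).symm ≪≫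
      Functor.isoWhiskerRight iF e.inverse ≪≫ Functor.associator Φ e.functor e.inverse ≪≫
      Functor.isoWhiskerLeft Φ e.unitIso.symm ≪≫ Φ.rightUnitor ≪≫ Φ.leftUnitor.symm
  -- `(G' ⋙ F') ⋙ Φ ≅ 𝟭 ⋙ Φ`
  let cGF : (G' ⋙ F') ⋙ Φ ≅ 𝟭 T ⋙ Φ :=
    Functor.associator G' F' Φ ≪≫ Functor.isoWhiskerLeft G' iF ≪≫ (Functor.associator G' Φ e.functor).symm ≪≫
      Functor.isoWhiskerRight iG e.functor ≪≫ Functor.associator Φ e.inverse e.functor ≪≫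
      Functor.isoWhiskerLeft Φ e.counitIso ≪≫ Φ.rightUnitor ≪≫ Φ.leftUnitor.symm
  let η : 𝟭 T ≅ F' ⋙ G' := (Functor.fullyFaithfulCancelRight Φ cFG).symm
  let ε : G' ⋙ F' ≅ 𝟭 T := Functor.fullyFaithfulCancelRight Φ cGF
  exact ⟨CategoryTheory.Equivalence.mk F' G' η ε, ⟨iF.symm⟩⟩

/-- **The criterion**: for a full and faithful `Φ : T ⥤ S`, `ReconstructibleAlong Φ` holds iff the
essential image of `Φ` is mapped into itself by every self-equivalence of `S`.
[claim: Mochizuki2012, status: disputed] -/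
theorem reconstructibleAlong_iff_essImage_invariant (Φ : T ⥤ S) [Φ.Full] [Φ.Faithful] :
    ReconstructibleAlong Φ ↔ ∀ (e : S ≌ S) (t : T), Φ.essImage (e.functor.obj (Φ.obj t)) :=
  ⟨essImage_invariant_of_reconstructibleAlong Φ, reconstructibleAlong_of_essImage_invariant Φ⟩

/-- A full and faithful functor that is also essentially surjective (an equivalence) is always
`ReconstructibleAlong`. [claim: Mochizuki2012, status: disputed] -/
theorem reconstructibleAlong_of_essSurj (Φ : T ⥤ S) [Φ.Full] [Φ.Faithful] [Φ.EssSurj] :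
    ReconstructibleAlong Φ :=
  reconstructibleAlong_of_essImage_invariant Φ fun _ _ => Functor.EssSurj.mem_essImage _ _

namespace BadLocalFrobenioid

variable {l : ℕ} {Kv : Type} [Field Kv] [ValuativeRel Kv]

/-- **Merge socket for [IUTchI] Ex. 3.2 (vi) (a)** (`v ∈ V̲^bad`): the typed node `DdashFromD`
("`D⊢_v ⊆ D_v` may be reconstructed category-theoretically from `D_v`", [AbsAnab] Lem. 1.3.8) follows from —
and by `reconstructibleAlong_iff_essImage_invariant` is equivalent to — the invariance of the essential image
of the full subcategory `D⊢_v` under every self-equivalence of `D_v`, which is what the anabelian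
characterisation supplies for the real `D_v = B^temp(X̲̲_v)⁰`. [claim: Mochizuki2012, status: disputed] -/
theorem ddashFromD_of_essImage_invariant (B : BadLocalFrobenioid.{u} l Kv)
    (h : ∀ (e : B.Dv ≌ B.Dv) (A : B.Ddash), B.incl.essImage (e.functor.obj (B.incl.obj A))) : B.DdashFromD :=
  reconstructibleAlong_of_essImage_invariant B.incl h

/-- Conversely, `DdashFromD` forces that invariance. [claim: Mochizuki2012, status: disputed] -/
theorem essImage_invariant_of_ddashFromD (B : BadLocalFrobenioid.{u} l Kv) (h : B.DdashFromD)
    (e : B.Dv ≌ B.Dv) (A : B.Ddash) : B.incl.essImage (e.functor.obj (B.incl.obj A)) :=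
  essImage_invariant_of_reconstructibleAlong B.incl h e A

end BadLocalFrobenioid

namespace GoodLocalFrobenioid

variable {p : ℕ} {Kv : Type} [Field Kv] [ValuativeRel Kv]

/-- **Merge socket for [IUTchI] Ex. 3.3 (iii) (a)** (`v ∈ V̲^good ∩ V̲^non`): the typed node `DdashFromD`
follows from (and is equivalent to) the invariance of the essential image of `D⊢_v ⊆ D_v` under every
self-equivalence of `D_v` ([AbsAnab] Lem. 1.3.8 for the real `D_v = B(X̲→_v)⁰`).
[claim: Mochizuki2012, status: disputed] -/
theorem ddashFromD_of_essImage_invariant (G : GoodLocalFrobenioid.{u} p Kv)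
    (h : ∀ (e : G.Dv ≌ G.Dv) (A : G.Ddash), G.incl.essImage (e.functor.obj (G.incl.obj A))) : G.DdashFromD :=
  reconstructibleAlong_of_essImage_invariant G.incl h

/-- Conversely, `DdashFromD` forces that invariance. [claim: Mochizuki2012, status: disputed] -/
theorem essImage_invariant_of_ddashFromD (G : GoodLocalFrobenioid.{u} p Kv) (h : G.DdashFromD)
    (e : G.Dv ≌ G.Dv) (A : G.Ddash) : G.incl.essImage (e.functor.obj (G.incl.obj A)) :=
  essImage_invariant_of_reconstructibleAlong G.incl h e A

end GoodLocalFrobenioid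

end Literature.IUT.HodgeTheaters
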